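import Summits.QuantumFields.YangMills.Theorems.BalabanUVNodesN11TopChildStepWeight

/-!
# DAG node N11 — THE STEP WEIGHT OF RECORD AT EVERY CHILD WITH `Ω_{k+1} = 𝕋` (no new large PLAQUETTE field; any new large-FLUCTUATION region, `Λ_{k+1}` arbitrary): the fibre of
# n02-b∕def-T's index map (3.5)∕(3.20) over such a child is `{(∅, ∅, (R, S)) : Λ_{k+1}(R) = Λ_{k+1}(s′)}`, and the resummed weight there is
# `w_k(s′)(U, V′) = a(∅)(V′) · b(∅, ∅)(U, V′) · Σ_{R : Λ_{k+1}(R) = Λ_{k+1}(s′)} Σ_S ζ_{k+1}(∅, ∅, (R, S))(U, V′)` — every (3.2) and (3.3) factor small, the residual summed over the `R`-fibre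

HEADER — WORK-UNIT METADATA.  Cell `pub-ymgap`, YM-PLAN Track A (HUMAN RULING D-0062), seat `pub-ymgap-dag-n11-d` (g18; N11 [B14], s2), route `BalabanUVNodes`, item K1⁹ =
stmt-QuantumFields-27364 (helper lane, `--kind proof --supports 27364 --as helper`, count-neutral).  [III] = [Balaban1988Convergent].  Sequel of this seat's g18
`…N11TopChildStepWeight` (p661425: the top child `Λ_{k+1} = 𝕋`, whose fibre is `{(∅,∅,(∅,S))}`), over n02-b∕def-T's `Node00.StepWeightsOfRecord` and g8's `…N11AllSmallEmptyExt`.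

WHY THIS FILE.  At a child `s′` with `Ω_{k+1}(s′) = 𝕋` NOTHING of the old field is retained by 11a's generation `k` (`B_k(Ω^c_{k+1}) = ∅`): the (O3′) identity there is chart-free and
frozen-variable-free exactly as at the top child, except that the NEW large-fluctuation region `Λ^c_{k+1} ≠ ∅` keeps an A-integral over `B_k(Λ^c_{k+1})` and a `Y`-sum over the admissible
`S_{k+1} ⊆ Λ^c_{k+1}` on the new side ((3.23)'s `ζ(∅) · Σ_S ∫dA|_{Λ^c} χ(Λ^c, S) e^{−½⟨A,𝒬A⟩} exp A_{k+1}`).  These children carry, together with the top child, the WHOLE weight of the labels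
`(P, Q) = (∅, ∅)` — the (3.2)∕(3.3)-small configurations, the physically dominant sector.  This file computes def-T's step weight on the OLD side of their identity; the sequel
`…N11OmegaTopTStep` unfolds 11a's `𝐓_{k+1}(s′)` on the new side.

WHAT THIS FILE PROVES (0 `def`, 0 `sorry`, standard axioms; every run, couplings, level, `A₁`, residual `ζ`).  §1 `LambdaOfLabel_eq_of_R` (`Λ_{k+1}(t)` reads `(P, Q, R)` only) ·
★ `σOfRecord_eq_iff_of_Omega_univ` (THE FIBRE over a child with `Ω_{k+1} = 𝕋`: `P = Q = ∅` and `Λ_{k+1}(∅,∅,R) = Λ_{k+1}(s′)`, `S` free) · `sum_filter_OmegaTop`.  §2 ★★ `wOfRecord_eq_of_Omega_univ`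
(the closed form above) · ★★ `wOfRecord_eq_prod_of_Omega_univ` (letters open: `a(∅) = Π_{ALL χ_{k+1}-cubes} χ`, `b(∅,∅) = χ′_k(ALL)`) · `wOfRecord_eq_of_Omega_univ_of_chiSeq_ne_zero` (on the
`χ_{k+1}(s′)`-support — which IS `{a(∅) ≠ 0}`, p661425 — the front product is `1`) · `wOfRecord_eq_zero_of_Omega_univ_of_chiFactor_eq_zero` ∕ `…_of_not_smallApproxFluct` (one (3.2)- or
(3.3)-large cube kills every such child, for EVERY residual `ζ`).

HONEST FRAMING.  Finite resummation + layer algebra over def-T's ∕ n02-b's typed objects (count-neutral bookkeeping); nothing of Bałaban's estimates asserted; no law of `ζ` used;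
N11 NOT discharged; K1⁹ NOT closed; no registered stub touched; counts unmoved (typed 28∕28 · discharged 5∕27 · A 5∕28).  One finite `𝕋⁴_{L^K}` programme at fixed `ε = L^{−K}` —
NOT ℝ⁴, NOT OS, NOT a mass gap, NOT Clay.  No `sorry`, `axiom`, `def`, `instance`, `notation`.  Sources (SHAPE only): [III] (2.1) p.254, (3.2)–(3.5) p.265, (3.16) p.268,
(3.20)–(3.21) p.269, (3.23)–(3.25) p.270, §3 p.267.
-/

noncomputable section

open scoped BigOperators

namespace Summit.QuantumFields.YangMills.Theorems.BalabanUVNodesN11OmegaTopStepWeight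

open Literature.MathematicalPhysics.QuantumFieldTheory.Balaban1983to89 T4Continuum Node00 B14.Eq218Concrete B14.Sect3Decomp
open BalabanUVNodesN11AllSmallEmptyExt (Zreg_eq_empty_of_Λ OmegaOfLabel_empty_empty_eq_univ)
open BalabanUVNodesN11TopChildStepWeight (fst_eq_empty_of_OmegaOfLabel_eq_univ snd_fst_eq_empty_of_OmegaOfLabel_eq_univ init_Λ_eq_univ_of_Ω_succ_eq_univ
  aWeight_empty_eq_prod_univ bWeight_empty_empty_eq_chiPrime_univ prod_chiFactor_eq_one_of_chiSeq_top_ne_zero)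

variable {F : T4Family} {N : ℕ} [NeZero N]

/-! ## §1. The fibre of the index map over a child with `Ω_{k+1} = 𝕋` -/

section Fibre

variable (F) (ν : Stage7Numerics) (M : ℕ) (p : B12.RunParams) (g : ℕ → ℝ) (k : ℕ)

omit [NeZero N] in
/-- `Λ_{k+1}(t)` of record reads the label only through `(P, Q, R)` — the large-fluctuation label `S_{k+1}` does not move the pair (`rfl`). [cite: Balaban1988Convergent, (3.20) p.269 (bookkeeping)] -/
theorem LambdaOfLabel_eq_of_R (s : SeqOfRecord F ν M g p.K k) (Pl Ql Rl Sl Sl' : Finset (Iχ F ν p g k)) :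
    LambdaOfLabel F ν M p g k s (Pl, Ql, (Rl, Sl)) = LambdaOfLabel F ν M p g k s (Pl, Ql, (Rl, Sl')) := rfl

omit [NeZero N] in
/-- ★ **THE FIBRE OF THE INDEX MAP OVER A CHILD WITH `Ω_{k+1} = 𝕋`**: for `s′` with `init s′ = s` and `Ω_{k+1}(s′) = 𝕋`, a label `t = (P, Q, R, S)_{k+1}` is mapped to `s′` by (3.5)∕(3.20)
iff `P = Q = ∅` and `Λ_{k+1}(∅, ∅, R) = Λ_{k+1}(s′)` — `S` is free. [cite: Balaban1988Convergent, (3.2)–(3.5) p.265, (3.16) p.268, (3.20)–(3.21) p.269, (2.1) p.254] -/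
theorem σOfRecord_eq_iff_of_Omega_univ (hD : 0 < sideD F ν M p g k) (s : SeqOfRecord F ν M g p.K k) (s' : SeqOfRecord F ν M g p.K (k + 1))
    (hs : s'.init = s) (hΩ : s'.Ω (k + 1) = Set.univ) (t : LbOfRecord F ν p g k) :
    σOfRecord F ν M p g k s t = s' ↔ t.1 = ∅ ∧ t.2.1 = ∅ ∧ LambdaOfLabel F ν M p g k s (∅, ∅, (t.2.2.1, ∅)) = s'.Λ (k + 1) := by
  obtain ⟨Pl, Ql, Rl, Sl⟩ := t
  constructor
  · intro h
    have hO : OmegaOfLabel F ν M p g k s (Pl, Ql, (Rl, Sl)) = Set.univ := by rw [← σOfRecord_Ω_succ F ν M p g k s, h, hΩ]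
    have hP : Pl = ∅ := fst_eq_empty_of_OmegaOfLabel_eq_univ F ν M p g k s _ hO
    have hQ : Ql = ∅ := snd_fst_eq_empty_of_OmegaOfLabel_eq_univ F ν M p g k hD s _ hO
    subst hP; subst hQ
    refine ⟨rfl, rfl, ?_⟩
    rw [LambdaOfLabel_eq_of_R F ν M p g k s ∅ ∅ Rl ∅ Sl, ← σOfRecord_Λ_succ F ν M p g k s, h]
  · rintro ⟨hP, hQ, hL⟩
    simp only at hP hQ hL
    subst hP; subst hQ
    have hΛk : 1 ≤ k → s.Λ k = Set.univ := fun hk => by rw [← hs]; exact init_Λ_eq_univ_of_Ω_succ_eq_univ F ν M p g k s' hΩ hk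
    have hO : OmegaOfLabel F ν M p g k s (∅, ∅, (Rl, Sl)) = Set.univ := OmegaOfLabel_empty_empty_eq_univ F ν M p g k hD s hΛk (Rl, Sl)
    rw [LambdaOfLabel_eq_of_R F ν M p g k s ∅ ∅ Rl ∅ Sl] at hL
    subst hs
    apply Seq.ext'
    · funext j
      by_cases hj : 1 ≤ j ∧ j ≤ k + 1
      · rcases Nat.lt_or_eq_of_le hj.2 with hlt | rfl
        · have hjk : j ≤ k := Nat.le_of_lt_succ hlt
          rw [σOfRecord, Seq.snoc_Ω_of_le _ _ hj.1 hjk, Seq.init_Ω _ hj.1 hjk]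
        · rw [σOfRecord_Ω_succ, hO, hΩ]
      · rw [(σOfRecord F ν M p g k s'.init (∅, ∅, (Rl, Sl))).Ω_off j hj, s'.Ω_off j hj]
    · funext j
      by_cases hj : 1 ≤ j ∧ j ≤ k + 1
      · rcases Nat.lt_or_eq_of_le hj.2 with hlt | rfl
        · have hjk : j ≤ k := Nat.le_of_lt_succ hlt
          rw [σOfRecord, Seq.snoc_Λ_of_le _ _ hj.1 hjk, Seq.init_Λ _ hj.1 hjk]
        · rw [σOfRecord_Λ_succ, hL]
      · rw [(σOfRecord F ν M p g k s'.init (∅, ∅, (Rl, Sl))).Λ_off j hj, s'.Λ_off j hj]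

omit [NeZero N] in
/-- Summing over the fibre `{(∅, ∅, (R, S)) : Λ(R) = Λ′}` is a restricted double sum over `(R, S)`. [cite: Balaban1988Convergent, (3.16) p.268, (3.20)–(3.21) p.269 (bookkeeping)] -/
theorem sum_filter_OmegaTop (s : SeqOfRecord F ν M g p.K k) (Λ' : Set (Site (F.P p.K) 0))
    [DecidablePred (fun t : LbOfRecord F ν p g k => t.1 = ∅ ∧ t.2.1 = ∅ ∧ LambdaOfLabel F ν M p g k s (∅, ∅, (t.2.2.1, ∅)) = Λ')]
    [DecidablePred (fun R : Finset (Iχ F ν p g k) => LambdaOfLabel F ν M p g k s (∅, ∅, (R, ∅)) = Λ')] (f : LbOfRecord F ν p g k → ℝ) :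
    ∑ t ∈ Finset.univ.filter (fun t : LbOfRecord F ν p g k => t.1 = ∅ ∧ t.2.1 = ∅ ∧ LambdaOfLabel F ν M p g k s (∅, ∅, (t.2.2.1, ∅)) = Λ'), f t =
      ∑ R : Finset (Iχ F ν p g k), ∑ S : Finset (Iχ F ν p g k),
        if LambdaOfLabel F ν M p g k s (∅, ∅, (R, ∅)) = Λ' then f (∅, ∅, (R, S)) else 0 := by
  classical
  rw [Finset.sum_filter]
  simp only [Fintype.sum_prod_type]
  rw [Finset.sum_eq_single (∅ : Finset (Iχ F ν p g k)) (fun P _ hP => by simp [hP]) (fun h => absurd (Finset.mem_univ _) h)]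
  rw [Finset.sum_eq_single (∅ : Finset (Iχ F ν p g k)) (fun Q _ hQ => by simp [hQ]) (fun h => absurd (Finset.mem_univ _) h)]
  simp only [true_and]

end Fibre

/-! ## §2. The closed form of the resummed step weight at a child with `Ω_{k+1} = 𝕋` -/

section ClosedForm

variable (F N) (ν : Stage7Numerics) (M : ℕ) (A₁ : ℝ) (p : B12.RunParams) (g : ℕ → ℝ) (k : ℕ)

open Classical in
/-- ★★ **THE STEP WEIGHT OF RECORD AT A CHILD WITH `Ω_{k+1} = 𝕋`**: `w_k(s′)(U, V′) = a(∅)(V′) · b(∅, ∅)(U, V′) · Σ_R [Λ_{k+1}(∅,∅,R) = Λ_{k+1}(s′)] Σ_S ζ_{k+1}(∅, ∅, (R, S))(U, V′)` — the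
(3.2) weight of `P = ∅`, the (3.3) weight of `(∅, ∅)`, and the residual summed over the `R`-fibre of the child's large-fluctuation region and the free label `S`.
[cite: Balaban1988Convergent, (3.2)–(3.5) p.265, (3.16) p.268, (3.20)–(3.21) p.269, §3 p.267, p.270] -/
theorem wOfRecord_eq_of_Omega_univ (ζ : ZetaOfRecord F N ν M) (hD : 0 < sideD F ν M p g k) (s' : SeqOfRecord F ν M g p.K (k + 1))
    (hΩ : s'.Ω (k + 1) = Set.univ) (U : GaugeField (F.P p.K) k (SU N)) (V' : GaugeField (F.P p.K) (k + 1) (SU N)) :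
    wOfRecord F N ν M A₁ ζ p g k s' U V' =
      aWeight F N ν M p g k s'.init ∅ V' * bWeight F N ν M p g k A₁ s'.init ∅ ∅ U V' *
        ∑ R : Finset (Iχ F ν p g k), ∑ S : Finset (Iχ F ν p g k),
          if LambdaOfLabel F ν M p g k s'.init (∅, ∅, (R, ∅)) = s'.Λ (k + 1) then ζ p g k s'.init ∅ ∅ (R, S) U V' else 0 := by
  rw [wOfRecord_apply, resumWeights]
  have hfilter : Finset.univ.filter (fun t : LbOfRecord F ν p g k => σOfRecord F ν M p g k s'.init t = s') =
      Finset.univ.filter (fun t : LbOfRecord F ν p g k => t.1 = ∅ ∧ t.2.1 = ∅ ∧ LambdaOfLabel F ν M p g k s'.init (∅, ∅, (t.2.2.1, ∅)) = s'.Λ (k + 1)) := by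
    ext t
    simp only [Finset.mem_filter, Finset.mem_univ, true_and]
    exact σOfRecord_eq_iff_of_Omega_univ F ν M p g k hD s'.init s' rfl hΩ t
  rw [hfilter, sum_filter_OmegaTop F ν M p g k s'.init (s'.Λ (k + 1)), Finset.mul_sum]
  refine Finset.sum_congr rfl fun R _ => ?_
  rw [Finset.mul_sum]
  refine Finset.sum_congr rfl fun S _ => ?_
  split_ifs
  · rw [ωOfRecord]
  · rw [mul_zero]

open Classical in
/-- ★★ **LETTERS OPEN**: at a child with `Ω_{k+1}(s′) = 𝕋`,
`w_k(s′)(U, V′) = (Π_{□′} χ_{□′}(V′)) · χ′_k(ALL cubes)(U, V′) · Σ_R [Λ_{k+1}(∅,∅,R) = Λ_{k+1}(s′)] Σ_S ζ_{k+1}(∅, ∅, (R, S))(U, V′)` — every (3.2) factor small at `V′`, every (3.3) factor small at `(U, V′)`.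
[cite: Balaban1988Convergent, (3.2)–(3.5) p.265, (3.16) p.268, (3.20)–(3.21) p.269, §3 p.267] -/
theorem wOfRecord_eq_prod_of_Omega_univ (ζ : ZetaOfRecord F N ν M) (hD : 0 < sideD F ν M p g k) (s' : SeqOfRecord F ν M g p.K (k + 1))
    (hΩ : s'.Ω (k + 1) = Set.univ) (U : GaugeField (F.P p.K) k (SU N)) (V' : GaugeField (F.P p.K) (k + 1) (SU N)) :
    wOfRecord F N ν M A₁ ζ p g k s' U V' =
      (∏ c : Iχ F ν p g k, chiFactor F N ν p g k c V') *
        chiPrime (sect3DataOfRecord F N ν M p g k s'.init) (avOfRecord F N p.K) (2 * deltaOfRecord ν g k A₁) (Finset.univ : Finset (Iχ F ν p g k)) U V' *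
          ∑ R : Finset (Iχ F ν p g k), ∑ S : Finset (Iχ F ν p g k),
            if LambdaOfLabel F ν M p g k s'.init (∅, ∅, (R, ∅)) = s'.Λ (k + 1) then ζ p g k s'.init ∅ ∅ (R, S) U V' else 0 := by
  have hZ : Zreg F ν M p g k s'.init = ∅ := Zreg_eq_empty_of_Λ F ν M p g k s'.init (init_Λ_eq_univ_of_Ω_succ_eq_univ F ν M p g k s' hΩ)
  rw [wOfRecord_eq_of_Omega_univ F N ν M A₁ p g k ζ hD s' hΩ U V', aWeight_empty_eq_prod_univ F N ν M p g k s'.init hZ V',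
    bWeight_empty_empty_eq_chiPrime_univ F N ν M A₁ p g k s'.init hZ U V']

open Classical in
/-- **ON THE `χ_{k+1}`-SUPPORT THE FRONT PRODUCT IS `1`**: where `χ_{k+1}(s′)(V′) ≠ 0`,
`w_k(s′)(U, V′) = χ′_k(ALL cubes)(U, V′) · Σ_R [Λ_{k+1}(∅,∅,R) = Λ_{k+1}(s′)] Σ_S ζ_{k+1}(∅, ∅, (R, S))(U, V′)`. [cite: Balaban1988Convergent, (3.2)–(3.3) p.265, p.267, (3.25) p.270] -/
theorem wOfRecord_eq_of_Omega_univ_of_chiSeq_ne_zero (ζ : ZetaOfRecord F N ν M) (hD : 0 < sideD F ν M p g k) (s' : SeqOfRecord F ν M g p.K (k + 1))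
    (hΩ : s'.Ω (k + 1) = Set.univ) (U : GaugeField (F.P p.K) k (SU N)) (V' : GaugeField (F.P p.K) (k + 1) (SU N))
    (hχ : chiSeqOfRecord F N ν M g p.K (k + 1) s' V' ≠ 0) :
    wOfRecord F N ν M A₁ ζ p g k s' U V' =
      chiPrime (sect3DataOfRecord F N ν M p g k s'.init) (avOfRecord F N p.K) (2 * deltaOfRecord ν g k A₁) (Finset.univ : Finset (Iχ F ν p g k)) U V' *
        ∑ R : Finset (Iχ F ν p g k), ∑ S : Finset (Iχ F ν p g k),
          if LambdaOfLabel F ν M p g k s'.init (∅, ∅, (R, ∅)) = s'.Λ (k + 1) then ζ p g k s'.init ∅ ∅ (R, S) U V' else 0 := by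
  rw [wOfRecord_eq_prod_of_Omega_univ F N ν M A₁ p g k ζ hD s' hΩ U V', prod_chiFactor_eq_one_of_chiSeq_top_ne_zero F N ν M p g k s' hΩ V' hχ, one_mul]

open Classical in
/-- **ONE (3.2)-LARGE CUBE KILLS EVERY CHILD WITH `Ω_{k+1} = 𝕋`** (every residual `ζ`). [cite: Balaban1988Convergent, (3.2) p.265, (3.5) p.265] -/
theorem wOfRecord_eq_zero_of_Omega_univ_of_chiFactor_eq_zero (ζ : ZetaOfRecord F N ν M) (hD : 0 < sideD F ν M p g k) (s' : SeqOfRecord F ν M g p.K (k + 1))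
    (hΩ : s'.Ω (k + 1) = Set.univ) (U : GaugeField (F.P p.K) k (SU N)) (V' : GaugeField (F.P p.K) (k + 1) (SU N))
    {c : Iχ F ν p g k} (hc : chiFactor F N ν p g k c V' = 0) : wOfRecord F N ν M A₁ ζ p g k s' U V' = 0 := by
  rw [wOfRecord_eq_prod_of_Omega_univ F N ν M A₁ p g k ζ hD s' hΩ U V', Finset.prod_eq_zero (Finset.mem_univ c) hc, zero_mul, zero_mul]

open Classical in
/-- **ONE (3.3)-LARGE CUBE KILLS EVERY CHILD WITH `Ω_{k+1} = 𝕋`** (every residual `ζ`). [cite: Balaban1988Convergent, (3.3)–(3.4) p.265, (3.5) p.265] -/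
theorem wOfRecord_eq_zero_of_Omega_univ_of_not_smallApproxFluct (ζ : ZetaOfRecord F N ν M) (hD : 0 < sideD F ν M p g k) (s' : SeqOfRecord F ν M g p.K (k + 1))
    (hΩ : s'.Ω (k + 1) = Set.univ) (U : GaugeField (F.P p.K) k (SU N)) (V' : GaugeField (F.P p.K) (k + 1) (SU N))
    {c : Iχ F ν p g k} (hc : ¬ SmallApproxFluct (sect3DataOfRecord F N ν M p g k s'.init) (avOfRecord F N p.K) (2 * deltaOfRecord ν g k A₁) U V' c) :
    wOfRecord F N ν M A₁ ζ p g k s' U V' = 0 := by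
  have hb : chiPrime (sect3DataOfRecord F N ν M p g k s'.init) (avOfRecord F N p.K) (2 * deltaOfRecord ν g k A₁) (Finset.univ : Finset (Iχ F ν p g k)) U V' = 0 := by
    unfold chiPrime
    exact Finset.prod_eq_zero (Finset.mem_univ c) (by rw [if_neg hc])
  rw [wOfRecord_eq_prod_of_Omega_univ F N ν M A₁ p g k ζ hD s' hΩ U V', hb, mul_zero, zero_mul]

end ClosedForm

end Summit.QuantumFields.YangMills.Theorems.BalabanUVNodesN11OmegaTopStepWeight

end
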